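import Summits.Ventures.Crystal3D.Theorems.StickyWulffConstantCoaxialWallLawPayerTwinCellTop
import Summits.Ventures.Crystal3D.Theorems.StickyWulffConstantCoaxialWallLawEndUniqueTwoPlate
import Summits.Ventures.Crystal3D.Theorems.StickyWulffConstantCoaxialWallLawPayerPairCount
import HarnessLib

/-!
# End accounting, census-free, multi-source V‴: the TWO-PLATE twin cell — both plates' in-plane words share one capacity

HONEST FRAMING. Part of the venture `Summits/Ventures/Crystal3D` (cell `crystal3d-full`), helper for the crux
`CoaxialWallLaw` (stmt-Ventures-19481) of `route-Ventures-StickyWulffConstant`, REGISTERED line `WallLedgerF`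
(planner cf-p1), open stub `stub_coaxialTwoSlabAdhesion` (general fillings).  Rung credit only; F-C1 not moved.
Memo HOME/wall-19481-p2/F-NEXT-SPEC.md §S1 (19481-p2 g4), planner (xxv) "two plates, end balls provably distinct".
The pooled end pairs of the bottom plate (`wordNet_twin_endPairs_multi`, `…PayerTwinCellExport`) and of the top plate
pulled back into the bottom word system (`wordNet_twin_endPairs_top`, `…PayerTwinCellTop`) are DISJOINT — different
roots: LEMMA X (`word_target_ne_of_roots_ne`); equal roots: LEMMA X″ (`word_target_ne_of_root_deepest`: a bottom chain's
deepest letter is oblique to the root, a top chain's is `e₃ ⟂` root) — and their union obeys the ONE family-blind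
capacity `card_endPairs_le_payers_closed`.  Hence the in-plane flux is charged TWICE:

`2 · (√2 · (Σ_{r ∈ RT} (F false r)₂) · π ρ²) − 24·(12√2π + 36R₀ + 55440) ρ ≤ 78 · #{z ∈ X : deg z ≤ 11, −R₀−2 ≤ z₂ ≤ h+R₀+2}`

(`wordNet_twin_payers_ge_twoPlate`; inputs `KissingGap δ`, `KissingClassification δ` only).

WHAT THIS IS NOT: not the assembly into the stub's inequality (next file, constant `√6/78`); F-C1 not moved.
-/

noncomputable section

namespace Summit.Ventures.Crystal3D.Theorems

open Summit.Ventures.Crystal3D Finset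
open Literature.MathematicalPhysics.StatisticalMechanics (fccStacking)
open scoped InnerProductSpace

open scoped Classical in
/-- **The two-plate twin cell.**  See the module docstring. -/
theorem wordNet_twin_payers_ge_twoPlate {δ : ℝ} (hg : KissingGap δ) (hc : KissingClassification δ)
    (L : EuclideanSpace ℝ (Fin 3) ≃ₗᵢ[ℝ] EuclideanSpace ℝ (Fin 3))
    (F : Bool → (EuclideanSpace ℝ (Fin 3) ≃ₗᵢ[ℝ] EuclideanSpace ℝ (Fin 3)))
    (hF : (F false = L ∧ F true = (ℝ ∙ EuclideanSpace.single (2 : Fin 3) (1 : ℝ)).reflection.trans L) ∨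
      (F false = (ℝ ∙ EuclideanSpace.single (2 : Fin 3) (1 : ℝ)).reflection.trans L ∧ F true = L))
    {n : EuclideanSpace ℝ (Fin 3)}
    (hn : n = L (EuclideanSpace.single (2 : Fin 3) (1 : ℝ)) ∨ n = -L (EuclideanSpace.single (2 : Fin 3) (1 : ℝ)))
    (s₁ s₂ : EuclideanSpace ℝ (Fin 3)) (X P₁ P₂ : Finset (EuclideanSpace ℝ (Fin 3))) (R₀ h ρ : ℝ)
    (hR₀ : 10 ≤ R₀) (hh : 0 ≤ h) (hρ : R₀ ≤ ρ)
    (hX : ∀ p ∈ X, ∀ q ∈ X, p ≠ q → 1 ≤ dist p q)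
    (hcell : ∀ p ∈ X, -(2 * R₀) ≤ p 2 ∧ p 2 ≤ h + 2 * R₀ ∧ p 0 ^ 2 + p 1 ^ 2 ≤ ρ ^ 2)
    (hP₁X : P₁ ⊆ X) (hP₂X : P₂ ⊆ X)
    (hP₁ : ∀ p, p ∈ P₁ ↔ (p ∈ (fun q => F false q + s₁) '' fccStacking 1 (Real.sqrt (2 / 3)) ∧
      -(2 * R₀) ≤ p 2 ∧ p 2 ≤ -R₀ ∧ p 0 ^ 2 + p 1 ^ 2 ≤ ρ ^ 2))
    (hP₂ : ∀ p, p ∈ P₂ ↔ (p ∈ (fun q => F true q + s₂) '' fccStacking 1 (Real.sqrt (2 / 3)) ∧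
      h + R₀ ≤ p 2 ∧ p 2 ≤ h + 2 * R₀ ∧ p 0 ^ 2 + p 1 ^ 2 ≤ ρ ^ 2)) :
    2 * (Real.sqrt 2 * (∑ r ∈ fccSlots.filter (fun r => ⟪F false r, n⟫_ℝ = 0 ∧ 0 < (F false r) 2), (F false r) 2) *
        Real.pi * ρ ^ 2) - 24 * (12 * Real.sqrt 2 * Real.pi + 36 * R₀ + 55440) * ρ ≤
      78 * ((X.filter fun z => (X.filter fun q => dist z q = 1).card ≤ 11 ∧
          -R₀ - 2 ≤ z 2 ∧ z 2 ≤ h + R₀ + 2).card : ℝ) := by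
  obtain ⟨Fw, hF0, hFc, T₁, hflux₁, hTpair₁, hTpay₁, hTwit₁⟩ :=
    wordNet_twin_endPairs_multi hg hc L F hF hn s₁ s₂ X P₁ P₂ R₀ h ρ hR₀ hh hρ hX hcell hP₁X hP₂X hP₁ hP₂
  obtain ⟨Fw₂, hF0₂, hFc₂, T₂, hflux₂, hTpair₂, hTpay₂, hTwit₂⟩ :=
    wordNet_twin_endPairs_top hg hc L F hF hn s₁ s₂ X P₁ P₂ R₀ h ρ hR₀ hh hρ hX hcell hP₁X hP₂X hP₁ hP₂
  -- the two word systems coincide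
  have hFw : Fw₂ = Fw := by
    funext κ
    induction κ with
    | nil => rw [hF0₂, hF0]
    | cons μ κ ih => rw [hFc₂, hFc, ih]
  subst hFw
  -- in-plane roots are horizontal model slots
  have hax : ∀ w, ⟪F false w, n⟫_ℝ = 0 ↔ w 2 = 0 := by
    intro w
    have h0 : ⟪F false w, L (EuclideanSpace.single (2 : Fin 3) (1 : ℝ))⟫_ℝ = w 2 := by
      rcases hF with ⟨h0, -⟩ | ⟨h0, -⟩ <;> rw [h0]
      · exact inner_frame_axis L w
      · exact inner_twinFrame_axis L w
    rcases hn with h' | h'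
    · rw [h', h0]
    · rw [h', inner_neg_right, h0, neg_eq_zero]
  have hr0 : 0 < Real.sqrt (2 / 3) := Real.sqrt_pos.2 (by norm_num)
  -- (1) the two pair sets are disjoint
  have hdisj : Disjoint T₁ T₂ := by
    rw [Finset.disjoint_left]
    intro bq h₁ h₂
    obtain ⟨r₁, hr₁, κ₁, hlet₁, hch₁, hdeep₁, hpat₁⟩ := hTwit₁ bq h₁
    obtain ⟨r₂, hr₂, κ₂, hlet₂, hch₂, ⟨l₂, hκ₂⟩, hpat₂⟩ := hTwit₂ bq h₂
    obtain ⟨hr₁S, hr₁n, hr₁up⟩ := mem_filter.1 hr₁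
    obtain ⟨hr₂S, hr₂n, hr₂up⟩ := mem_filter.1 hr₂
    by_cases hrr : r₁ = r₂
    · subst hrr
      have hdeep₁' : ∀ (l : List (EuclideanSpace ℝ (Fin 3))) (μ : EuclideanSpace ℝ (Fin 3)), κ₁ = l ++ [μ] →
          ⟪r₁, μ⟫_ℝ ≠ 0 := by
        intro l μ hl h0; have := hdeep₁ l μ hl; rw [h0] at this; exact hr0.ne this
      have hν : ⟪r₁, EuclideanSpace.single (2 : Fin 3) (1 : ℝ)⟫_ℝ = 0 := by
        rw [← apply_two_eq_inner_e₃]; exact (hax r₁).1 hr₁n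
      exact word_target_ne_of_root_deepest hX hFc hlet₁ hlet₂ hch₁ hch₂ hr₁S hdeep₁' hκ₂ hν rfl rfl hpat₁ hpat₂ rfl
    · have hne' : r₁ ≠ -r₂ := by
        intro h'
        rw [h', map_neg, PiLp.neg_apply] at hr₁up
        linarith
      exact word_target_ne_of_roots_ne hX hFc hlet₁ hlet₂ hch₁ hch₂ hr₁S hr₂S hrr hne' rfl rfl hpat₁ hpat₂ rfl
  -- (2) one capacity for the union
  have hU := card_endPairs_le_payers_closed hX (T₁.disjUnion T₂ hdisj) (R₀ := R₀) (h := h)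
    (fun bq hbq => by
      rcases mem_disjUnion.1 hbq with h' | h'
      · obtain ⟨a, b, c, d, e⟩ := hTpair₁ bq h'
        exact ⟨a, b, c, d, e.le⟩
      · exact hTpair₂ bq h')
    (fun bq hbq => by
      rcases mem_disjUnion.1 hbq with h' | h'
      · exact hTpay₁ bq h'
      · exact hTpay₂ bq h')
  rw [card_disjUnion] at hU
  have hPAYeq : (X.filter fun z => (X.filter fun q => dist z q = 1).card ≤ 11 ∧
      -R₀ - 1 - 1 ≤ z 2 ∧ z 2 ≤ h + R₀ + 1 + 1) =
      (X.filter fun z => (X.filter fun q => dist z q = 1).card ≤ 11 ∧ -R₀ - 2 ≤ z 2 ∧ z 2 ≤ h + R₀ + 2) := by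
    refine filter_congr fun z _ => ?_
    rw [show -R₀ - 1 - 1 = -R₀ - 2 by ring, show h + R₀ + 1 + 1 = h + R₀ + 2 by ring]
  rw [hPAYeq] at hU
  have hcast : ((T₁.card : ℕ) : ℝ) + (T₂.card : ℝ) ≤
      78 * ((X.filter fun z => (X.filter fun q => dist z q = 1).card ≤ 11 ∧
          -R₀ - 2 ≤ z 2 ∧ z 2 ≤ h + R₀ + 2).card : ℝ) := by
    exact_mod_cast hU
  linarith only [hflux₁, hflux₂, hcast]

end Summit.Ventures.Crystal3D.Theorems

end
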